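import Summits.BirchSwinnertonDyer.BirchSwinnertonDyer.Theorems.UniversalToricDescentThinCombCharacterGrid
import Summits.BirchSwinnertonDyer.BirchSwinnertonDyer.Theorems.UniversalToricDescentThinCombColumnTwist
import Summits.BirchSwinnertonDyer.BirchSwinnertonDyer.Theorems.UniversalToricDescentThinCombBinomialValues
import Summits.BirchSwinnertonDyer.BirchSwinnertonDyer.Theorems.UniversalToricDescentThinCombFrameUniqueness
import Literature.NumberTheory.EllipticCurves.ZpExtensionPairTowerUniversalProofs
import HarnessLib

/-!
# THE FRAME FUNCTIONAL EQUATION: `φ_{A_τ} L₂ = [g₀] · L₂` for a GROUP ELEMENT `g₀ ∈ Γ_K` — EVERY ♯♯-frame satisfies the symmetry clause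
# `φ_{A_τ} L₂ ∼ L₂`, with NO normalisation of its constants
# (helper on the rational wall `RationalSplitIMCInclusionAtThree`, stmt-BirchSwinnertonDyer-24207, line `ratwall_thin_comb` v10 → v11;
# cell `pub/bsd-wall`, LEAD `cruxlead-24207` g38; `--supports stmt-BirchSwinnertonDyer-24207`; nothing is closed; BSD is not proved)

WHY THIS FILE. Since v8.2 the first stub of the line asks for a ♯♯-frame `L₂` (`IsToricTwoVarLFunctionUpTo₂ C X Y …`) TOGETHER WITH the
symmetry clause (ii) `φ_{A_τ} L₂ ∼ L₂` under the frame involution `A_τ` of Büyükboduk–Lei's `τ = c∘ι` (consumed by the weak-reflection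
rigidity of the composition). v8.3–v10 derived (ii) from (i) only for frames whose grading ratio `λ₀ = X·κ̂/Y` is a unit of `ℤ₃`
(`…FrameUniqueness.associated_frameSubst_of_ratio_unit`), which is why stub 1 became the NORMALISED existence (N) / (N♭). This file proves
(ii) for EVERY frame, so that stub 1 can be the BARE existence of a ♯♯-frame (skeleton v11, certificate `…ClosedModuloV87`):

  **`exists_frameSubst_eq_groupLike_mul`**: `φ_{A_τ} L₂ = (1+T₁)^{κ₁ g₀}(1+T₂)^{κ₂ g₀} · L₂` for some `g₀ ∈ Γ_K`;
  **`associated_frameSubst`**: `Associated (φ_{A_τ} L₂) L₂` (the group-like element is a unit).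

PROOF (p = 3; Jacquet's cone fact BY NAME for the grid). Character grid (`…CharacterGrid`): data `ψ_{ij}` of type `(m(i+1), −m(j+1))` with
avatars `r_{ij}(g) = r₁(g)^{i+1} r₂(g)^{j+1}` at the points `P_{ij} = (v₁^{j+1}u^{i+1} − 1, v₂^{j+1} − 1)`, `u = r₁(γ₁)`, `r₁(γ₂) = 1`,
`(v₁, v₂) = (r₂(γ₁), r₂(γ₂))`. `G = φ_A L₂` is a `(C, Xλ₀⁻¹, Yλ₀)`-frame (`…FrameReflection`), so `G(P_{ij})·μ^{i+1} = μ^{j+1}·L₂(P_{ij})`,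
`μ = λ₀^m`, `‖μ‖ = 1` (`…SizeRigidity`). (1) WILD STEP in `T₁` (as `…WildRigidity`): `μ⁻¹ = Q₁(u − 1)` with `(1+X)Q₁′ = zQ₁`, `z ∈ ℤ₃`;
so `r₁(g₁) = μ⁻¹` for `g₁` with `κ₁ g₁ = z` (`…BinomialValues`), and `L′ = [g₁]·L₂` has `G(P_{ij}) = w^{j+1}·L′(P_{ij})`, `w = μ·r₂(g₁)⁻¹`.
(2) COLUMN TWIST in `T₂` (`…ColumnTwist`): `w = Q₂(v₂ − 1)`, `(1+X)Q₂′ = eQ₂`, `e ∈ ℤ₃`; so `r₂(g′) = w`, `r₁(g′) = 1` for `g′` with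
coordinates `(0, e)`. (3) `g₀ = g₁g′`: `r₁(g₀) = μ⁻¹`, `r₂(g₀) = μ`, hence `[g₀](P_{ij}) = μ^{j−i} = G(P_{ij})/L₂(P_{ij})`, and `G − [g₀]L₂`
vanishes on the grid, so it is `0` (fibred identity principle `…ReflectionTransfer.unr_eq_zero_of_infinite_zeros₂_innerFibred`).

HONEST SCOPE: a statement about the interpolation PREDICATE, conditional on `jacquet1972_functionalEquation_rankinSelbergHecke_cone`; nothing here
is evidence that a ♯♯-frame exists at the additive split `3`; BSD is proved for no curve; 24207 / 20395 / 20186 / 32493 OPEN.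

References: [cite: HaoLoeffler2025, §4 Thm. 4.9 (arXiv:2405.12611)] [cite: BuyukbodukLei2017, Def. 3.8 (arXiv:1707.00557)]
[cite: Jacquet1972, §19 Thm. 19.14, Cor. 19.15] [cite: Robert2000PadicAnalysis, Ch. V §2.4, Ch. VI §2.1–2.4] [cite: Gouvea1993PadicNumbers, §5.6, §5.9]
[cite: deShalit1987, II.4.17 (54), II.6.4] [cite: NeukirchSchmidtWingberg2008, (5.3.5)]
-/

set_option linter.dupNamespace false
set_option autoImplicit false

noncomputable section

open scoped Classical MatrixGroups
open Filter Topology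

namespace Summit.BirchSwinnertonDyer.BirchSwinnertonDyer.Theorems.UniversalToricDescentThinComb.FrameFunctionalEquation

open NumberField IsDedekindDomain Field
open Literature.NumberTheory.EllipticCurves Literature.NumberTheory.GaloisRepresentations Literature.NumberTheory.LocalFields
open Summit.BirchSwinnertonDyer.Rank1Residual.X11b.Halves
open Summit.BirchSwinnertonDyer.BirchSwinnertonDyer.Theorems.UniversalToricDescentThinComb

variable {K : Type} [Field K] [NumberField K]

/-- The value of a series at `0` is its constant coefficient (`HasSum` form). [folklore] -/
theorem hasSum_coeff_mul_zero_pow (Q : PowerSeries ℂ_[3]) :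
    HasSum (fun n ↦ PowerSeries.coeff n Q * (0 : ℂ_[3]) ^ n) (PowerSeries.constantCoeff Q) := by
  have h := hasSum_single (f := fun n ↦ PowerSeries.coeff n Q * (0 : ℂ_[3]) ^ n) 0
    (fun n hn ↦ by rw [zero_pow hn, mul_zero])
  simpa using h

/-- **THE FRAME FUNCTIONAL EQUATION `φ_{A_τ} L₂ = [g₀] · L₂`.** `K` imaginary quadratic Heegner for `N`, `3 = 𝔭𝔭′` with `𝔭` of degree one
induced by `ι′`, `(κ₁, κ₂; γ₁, γ₂)` a generator pair with `κ₁` unramified outside `𝔭`, `f = Dt.f`, `c ∉ res Γ_K`, `τ` a lift of `g ↦ c g⁻¹ c⁻¹`,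
`A = A_τ` its frame matrix; Jacquet's cone fact BY NAME. For EVERY ♯♯-frame `L₂` with constants `(C, X, Y)`, `X, Y ≠ 0`, there is `g₀ ∈ Γ_K`
with `φ_A L₂ = (1+T₁)^{κ₁ g₀}(1+T₂)^{κ₂ g₀} · L₂`. [cite: HaoLoeffler2025, §4 Thm. 4.9 (arXiv:2405.12611)] [cite: BuyukbodukLei2017, Def. 3.8 (arXiv:1707.00557)]
[cite: Robert2000PadicAnalysis, Ch. V §2.4 Theorem 1; Ch. VI §2.1, §2.4] [cite: Gouvea1993PadicNumbers, §5.6 Cor. 5.6.4; §5.9 Problem 194] -/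
theorem exists_frameSubst_eq_groupLike_mul (hJ : jacquet1972_functionalEquation_rankinSelbergHecke_cone)
    (hK : IsImaginaryQuadratic K) {N : ℕ} [NeZero N] (W : WeierstrassCurve ℚ)
    (Dt : Literature.NumberTheory.EllipticCurves.ModularForms.ModularParametrizationData W N)
    (hH : SatisfiesHeegnerHypothesis N K)
    {𝔭 : HeightOneSpectrum (𝓞 K)} (h3 : ((3 : ℕ) : 𝓞 K) ∈ 𝔭.asIdeal)
    {𝔭' : HeightOneSpectrum (𝓞 K)} (h3' : ((3 : ℕ) : 𝓞 K) ∈ 𝔭'.asIdeal) (hne : 𝔭' ≠ 𝔭)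
    (ι' : PadicAlgCl 3 ≃+* ℂ) (hι : Summit.BirchSwinnertonDyer.BirchSwinnertonDyer.Theorems.SchneiderFree.BranchInducesPrime 3 ι' 𝔭)
    {κ₁ κ₂ : ZpExtension K 3} {γ₁ γ₂ : absoluteGaloisGroup K} (hpair : ZpExtension.IsTopGeneratorPair κ₁ κ₂ γ₁ γ₂)
    (hur₁ : ∀ v : HeightOneSpectrum (𝓞 K), v ≠ 𝔭 → ∀ 𝔓 ∈ v.primesAbove,
      𝔓.inertia (absoluteGaloisGroup K) ≤ κ₁.kerSubgroup)
    {c : absoluteGaloisGroup ℚ} (hc : c ∉ Set.range (absGaloisRestrict ℚ K))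
    {τ : absoluteGaloisGroup K → absoluteGaloisGroup K}
    (hτ : ∀ σ, absGaloisRestrict ℚ K (τ σ) = c * (absGaloisRestrict ℚ K σ)⁻¹ * c⁻¹)
    (A : GL (Fin 2) ℤ_[3]) (hA : (A : Matrix (Fin 2) (Fin 2) ℤ_[3]) = IwasawaAlgebra₂.frameMatrixOf κ₁ κ₂ γ₁ γ₂ τ)
    {ΩK : ℂ} {C X Y : ℂ_[3]} {L₂ : PowerSeries (UnrSeries 3)} (hX : X ≠ 0) (hY : Y ≠ 0)
    (hL : IsToricTwoVarLFunctionUpTo₂ C X Y ι' 𝔭 𝔭' κ₁ κ₂ γ₁ γ₂ Dt.f ΩK L₂) :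
    letI : Algebra ℤ_[3] (unrIntegers 3) := (toUnr 3).toAlgebra
    ∃ g₀ : absoluteGaloisGroup K,
      IwasawaAlgebra₂.frameSubst (unrIntegers 3) A L₂ =
        (PowerSeries.map (PowerSeries.C (R := unrIntegers 3))
            ((PowerSeries.binomialSeries ℤ_[3] (Multiplicative.toAdd (κ₁ g₀))).map (toUnr 3)) *
          PowerSeries.C ((PowerSeries.binomialSeries ℤ_[3] (Multiplicative.toAdd (κ₂ g₀))).map (toUnr 3))) * L₂ := by
  letI : Algebra ℤ_[3] (unrIntegers 3) := (toUnr 3).toAlgebra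
  -- the zero frame
  by_cases hL0 : L₂ = 0
  · exact ⟨1, by rw [hL0, map_zero, mul_zero]⟩
  -- the character grid of THIS `τ`
  obtain ⟨r₁, r₂, u, v₁, v₂, m, hm, hr₁κ, hr₂κ, hr₁γ₁, hr₁γ₂, hr₂γ₁, hr₂γ₂, hu, hv₁, hv₂, hut, hv₂t, grid⟩ :=
    CharacterGrid.characterGrid hJ (by norm_num) hK W Dt hH h3 h3' hne ι' hι hpair hur₁ hc hτ
  choose ψ r Lc hinf hunr hr hrκ hLd hLe hprod hx hy using grid
  -- the reflected frame and the grading ratio (size rigidity: a unit)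
  have hG := FrameReflection.isToricTwoVarLFunctionUpTo₂_frameSubst_involution hJ hK Dt.f Dt.isNewformOf.1 hH h3 h3' hne ι'
    hpair hc hτ A hA hL
  set G : PowerSeries (UnrSeries 3) := IwasawaAlgebra₂.frameSubst (unrIntegers 3) A L₂ with hGdef
  have hsize := SizeRigidity.norm_mul_eq_norm_of_isToricTwoVarLFunctionUpTo₂ hJ hK W Dt hH h3 h3' hne ι' hι hpair hur₁ hX hY hL hL0
  set κh : ℂ_[3] := (((ι'.symm ((N : ℂ) * ((NumberField.discr K).natAbs : ℂ) / 4) : PadicAlgCl 3)) : ℂ_[3]) with hκh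
  have hκh0 : κh ≠ 0 := by
    intro h0; rw [h0, mul_zero, norm_zero] at hsize; exact hY (norm_eq_zero.mp hsize.symm)
  set lam : ℂ_[3] := X * κh * Y⁻¹ with hlam
  have hlam1 : ‖lam‖ = 1 := by
    rw [hlam, norm_mul, norm_inv, hsize, mul_inv_cancel₀ (norm_ne_zero_iff.mpr hY)]
  have hμ1 : ‖lam ^ m‖ = 1 := by rw [norm_pow, hlam1, one_pow]
  have hμ0 : lam ^ m ≠ 0 := norm_ne_zero_iff.mp (by rw [hμ1]; exact one_ne_zero)
  -- bookkeeping of the grid (as in `…SizeRigidity`, `…WildRigidity`)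
  have h31 : ‖((3 : ℕ) : ℂ_[3])‖ < 1 := norm_prime_padicComplex_lt_one
  have h30 : ((3 : ℕ) : ℂ_[3]) ≠ 0 := by exact_mod_cast (show (3 : ℕ) ≠ 0 by norm_num)
  have hc0 : 0 < ‖((3 : ℕ) : ℂ_[3])‖ := norm_pos_iff.mpr h30
  have hu1 : ‖u - 1‖ ≤ 1 := (hu.trans h31).le
  have hv₁1 : ‖v₁ - 1‖ ≤ 1 := (hv₁.trans h31).le
  have hv₂1 : ‖v₂ - 1‖ ≤ 1 := (hv₂.trans h31).le
  have hu_ne : u ≠ 0 := fun h ↦ by rw [h, zero_sub, norm_neg, norm_one] at hu; exact (lt_irrefl _) (hu.trans h31)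
  have hv₁_ne : v₁ ≠ 0 := fun h ↦ by rw [h, zero_sub, norm_neg, norm_one] at hv₁; exact (lt_irrefl _) (hv₁.trans h31)
  have hv₂_ne : v₂ ≠ 0 := fun h ↦ by rw [h, zero_sub, norm_neg, norm_one] at hv₂; exact (lt_irrefl _) (hv₂.trans h31)
  have hv₁n : ‖v₁‖ ≤ 1 := RamifiedSevenEllipticUnits.LemmaXi.norm_le_one_of_norm_sub_one_le_one hv₁1
  have hv₁pow : ∀ j : ℕ, ‖v₁ ^ (j + 1) - 1‖ < ‖((3 : ℕ) : ℂ_[3])‖ := fun j ↦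
    (RamifiedSevenEllipticUnits.LemmaXi.norm_pow_sub_one_le hv₁1 _).trans_lt hv₁
  have hv₂pow : ∀ j : ℕ, ‖v₂ ^ (j + 1) - 1‖ ≤ ‖((3 : ℕ) : ℂ_[3])‖ := fun j ↦
    ((RamifiedSevenEllipticUnits.LemmaXi.norm_pow_sub_one_le hv₂1 _).trans_lt hv₂).le
  have hpt : ∀ i j : ℕ, ‖v₁ ^ (j + 1) * u ^ (i + 1) - 1‖ ≤ ‖((3 : ℕ) : ℂ_[3])‖ := fun i j ↦
    (FibredSupply.norm_mul_sub_one_lt (by rw [norm_pow]; exact pow_le_one₀ (norm_nonneg _) hv₁n) (hv₁pow j)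
      ((RamifiedSevenEllipticUnits.LemmaXi.norm_pow_sub_one_le hu1 _).trans_lt hu)).le
  have hxlt : ∀ i j : ℕ, ‖v₁ ^ (j + 1) * u ^ (i + 1) - 1‖ < 1 := fun i j ↦ (hpt i j).trans_lt h31
  have hylt : ∀ j : ℕ, ‖v₂ ^ (j + 1) - 1‖ < 1 := fun j ↦ (hv₂pow j).trans_lt h31
  have hut1 : ∀ t : ℕ, ‖u ^ t - 1‖ ≤ ‖((3 : ℕ) : ℂ_[3])‖ := fun t ↦
    ((RamifiedSevenEllipticUnits.LemmaXi.norm_pow_sub_one_le hu1 t).trans_lt hu).le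
  have hinjD : Function.Injective fun j : ℕ ↦ v₂ ^ (j + 1) - 1 := by
    simpa only [one_mul] using FibredSupply.injective_mul_pow_sub_one one_ne_zero hv₂_ne hv₂t
  have hinjF : ∀ j : ℕ, Function.Injective fun i : ℕ ↦ v₁ ^ (j + 1) * u ^ (i + 1) - 1 := fun j ↦
    FibredSupply.injective_mul_pow_sub_one (pow_ne_zero _ hv₁_ne) hu_ne hut
  -- the two value families on the grid and their relation
  obtain ⟨D, hD⟩ : ∃ D : ℕ → ℕ → ℂ_[3], ∀ i j, D i j =
      (((ι'.symm (toricInterpolationValue 3 Dt.f 𝔭 𝔭' (ψ i j) (m * (i + 1)) (m * (j + 1)) ΩK (Lc i j 1))) : PadicAlgCl 3) :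
        ℂ_[3]) := ⟨_, fun _ _ ↦ rfl⟩
  obtain ⟨VL, hVL⟩ : ∃ VL : ℕ → ℕ → ℂ_[3], ∀ i j, VL i j = C * X ^ (m * (i + 1)) * Y ^ (m * (j + 1)) * D i j :=
    ⟨_, fun _ _ ↦ rfl⟩
  obtain ⟨VG, hVG⟩ : ∃ VG : ℕ → ℕ → ℂ_[3], ∀ i j,
      VG i j = C * (Y * κh⁻¹) ^ (m * (i + 1)) * (X * κh) ^ (m * (j + 1)) * D i j := ⟨_, fun _ _ ↦ rfl⟩
  have ha : ∀ i : ℕ, 1 ≤ m * (i + 1) := fun i ↦ Nat.mul_pos hm (Nat.succ_pos i)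
  have hvalL : ∀ i j, UnrSeries.HasValueAt₂ L₂ (v₁ ^ (j + 1) * u ^ (i + 1) - 1) (v₂ ^ (j + 1) - 1) (VL i j) := by
    intro i j
    have h := hL (ψ i j) _ _ (ha i) (ha j) (hinf i j) (hunr i j) (r i j) (hr i j) (hrκ i j) (Lc i j) (hLd i j) (hLe i j)
    rw [hx i j, hy i j, ← hD] at h
    rwa [hVL]
  have hvalG : ∀ i j, UnrSeries.HasValueAt₂ G (v₁ ^ (j + 1) * u ^ (i + 1) - 1) (v₂ ^ (j + 1) - 1) (VG i j) := by
    intro i j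
    have h := hG (ψ i j) _ _ (ha i) (ha j) (hinf i j) (hunr i j) (r i j) (hr i j) (hrκ i j) (Lc i j) (hLd i j) (hLe i j)
    rw [hx i j, hy i j, ← hD] at h
    rwa [hVG]
  have hrel : ∀ i j, VG i j * (lam ^ m) ^ (i + 1) = (lam ^ m) ^ (j + 1) * VL i j := by
    intro i j
    have e1 : Y * κh⁻¹ * lam = X := by
      rw [hlam]
      calc Y * κh⁻¹ * (X * κh * Y⁻¹) = X * (κh⁻¹ * κh) * (Y * Y⁻¹) := by ring
        _ = X := by rw [inv_mul_cancel₀ hκh0, mul_inv_cancel₀ hY, mul_one, mul_one]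
    have e2 : lam * Y = X * κh := by
      rw [hlam]
      calc X * κh * Y⁻¹ * Y = X * κh * (Y⁻¹ * Y) := by ring
        _ = X * κh := by rw [inv_mul_cancel₀ hY, mul_one]
    rw [← pow_mul, ← pow_mul]
    calc VG i j * lam ^ (m * (i + 1))
        = C * (Y * κh⁻¹ * lam) ^ (m * (i + 1)) * (X * κh) ^ (m * (j + 1)) * D i j := by rw [hVG, mul_pow]; ring
      _ = C * X ^ (m * (i + 1)) * (lam * Y) ^ (m * (j + 1)) * D i j := by rw [e1, e2]
      _ = lam ^ (m * (j + 1)) * VL i j := by rw [hVL, mul_pow]; ring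
  set d : ℂ_[3] := (lam ^ m)⁻¹ with hd
  have hd0 : d ≠ 0 := inv_ne_zero hμ0
  have hVGd : ∀ i j, VG i j = d ^ (i + 1) * (lam ^ m) ^ (j + 1) * VL i j := by
    intro i j
    have hMp : (lam ^ m) ^ (i + 1) ≠ 0 := pow_ne_zero _ hμ0
    calc VG i j = VG i j * (lam ^ m) ^ (i + 1) * ((lam ^ m) ^ (i + 1))⁻¹ := by rw [mul_assoc, mul_inv_cancel₀ hMp, mul_one]
      _ = d ^ (i + 1) * (lam ^ m) ^ (j + 1) * VL i j := by rw [hrel, hd, inv_pow]; ring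
  -- ### (1) WILD STEP in the first variable: `(λ₀^m)⁻¹ = Q₁(u − 1)` (the argument of `…WildRigidity` on this grid)
  have hex : ∃ j₀ i₀ : ℕ, VL i₀ j₀ ≠ 0 := by
    by_contra hall
    push Not at hall
    apply hL0
    refine ReflectionTransfer.unr_eq_zero_of_infinite_zeros₂_innerFibred h30 h31 (Set.infinite_range_of_injective hinjD) ?_ ?_
    · rintro y ⟨j, rfl⟩; exact hv₂pow j
    · rintro y ⟨j, rfl⟩
      refine Set.infinite_of_injective_forall_mem (hinjF j) fun i ↦ ⟨hpt i j, ?_⟩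
      have hv := hvalL i j
      rwa [hall j i] at hv
  obtain ⟨j₀, i₀, hne0⟩ := hex
  obtain ⟨F, hFint, hFval⟩ := NodeSeries.exists_fibreSeries L₂ (hylt j₀)
  obtain ⟨F', hF'int, hF'val⟩ := NodeSeries.exists_fibreSeries G (hylt j₀)
  have hFL : ∀ i : ℕ, ∑' n, PowerSeries.coeff n F * (v₁ ^ (j₀ + 1) * u ^ (i + 1) - 1) ^ n = VL i j₀ := fun i ↦
    ((hFval _ _ (hxlt i j₀)).mp (hvalL i j₀)).tsum_eq
  have hFG : ∀ i : ℕ, ∑' n, PowerSeries.coeff n F' * (v₁ ^ (j₀ + 1) * u ^ (i + 1) - 1) ^ n = VG i j₀ := fun i ↦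
    ((hF'val _ _ (hxlt i j₀)).mp (hvalG i j₀)).tsum_eq
  obtain ⟨i₁, hi₁⟩ := NodeSeries.exists_forall_le_ne_zero hFint hc0 h31 (hinjF j₀) (fun i ↦ hpt i j₀) (i₀ := i₀)
    (by simpa only [hFL] using hne0)
  have hVLne : ∀ t : ℕ, VL (i₁ + t) j₀ ≠ 0 := fun t ↦ by rw [← hFL]; exact hi₁ _ (Nat.le_add_right _ _)
  set a : ℂ_[3] := v₁ ^ (j₀ + 1) * u ^ (i₁ + 1) with ha_def
  have hξ : ‖a - 1‖ ≤ ‖((3 : ℕ) : ℂ_[3])‖ := hpt i₁ j₀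
  have ha1 : ‖a‖ ≤ 1 := RamifiedSevenEllipticUnits.LemmaXi.norm_le_one_of_norm_sub_one_le_one (hξ.trans h31.le)
  obtain ⟨H, hHint, hHval⟩ := NodeSeries.exists_recenter_rescale hFint hc0 h31 hξ ha1
  obtain ⟨H', hH'int, hH'val⟩ := NodeSeries.exists_recenter_rescale hF'int hc0 h31 hξ ha1
  have hnode : ∀ t : ℕ, a * (u ^ t - 1) + (a - 1) = v₁ ^ (j₀ + 1) * u ^ (i₁ + t + 1) - 1 := fun t ↦ by
    rw [ha_def]; ring
  have hHL : ∀ t : ℕ, ∑' n, PowerSeries.coeff n H * (u ^ t - 1) ^ n = VL (i₁ + t) j₀ := fun t ↦ by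
    rw [hHval _ (hut1 t), hnode, hFL]
  have hHG : ∀ t : ℕ, ∑' n, PowerSeries.coeff n H' * (u ^ t - 1) ^ n = VG (i₁ + t) j₀ := fun t ↦ by
    rw [hH'val _ (hut1 t), hnode, hFG]
  set c₀ : ℂ_[3] := (lam ^ m) ^ (j₀ + 1) * d ^ (i₁ + 1) with hc₀
  have hc₀0 : c₀ ≠ 0 := mul_ne_zero (pow_ne_zero _ hμ0) (pow_ne_zero _ hd0)
  have hrelt : ∀ t : ℕ, ∑' n, PowerSeries.coeff n H' * (u ^ t - 1) ^ n =
      c₀ * d ^ t * ∑' n, PowerSeries.coeff n H * (u ^ t - 1) ^ n := by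
    intro t
    rw [hHL, hHG, hVGd, hc₀, show i₁ + t + 1 = (i₁ + 1) + t by ring, pow_add]
    ring
  have h00 : ∑' n, PowerSeries.coeff n H * (u ^ 0 - 1) ^ n ≠ 0 := by rw [hHL]; exact hVLne 0
  obtain ⟨z, Q, hHQ, hODE, hQbd⟩ :=
    PadicComplex.exists_padicInt_binomial_twist_of_node_values hHint hH'int (hu.trans h31) hut hc₀0 hd0 hrelt h00
  have hQres : PowerSeries.IsRestricted ‖((3 : ℕ) : ℂ_[3])‖ Q := isRestricted_of_norm_coeff_le hQbd hc0.le h31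
  have hHres : PowerSeries.IsRestricted ‖((3 : ℕ) : ℂ_[3])‖ H := isRestricted_of_norm_coeff_le hHint hc0.le h31
  have hQt : ∀ t : ℕ, ∑' n, PowerSeries.coeff n Q * (u ^ t - 1) ^ n = c₀ * d ^ t := by
    intro t
    have h1 : (∑' n, PowerSeries.coeff n Q * (u ^ t - 1) ^ n) * VL (i₁ + t) j₀ = c₀ * d ^ t * VL (i₁ + t) j₀ := by
      rw [← hHL t, ← tsum_coeff_mul hQres hHres (hut1 t), ← hHQ, hrelt t]
    exact mul_right_cancel₀ (hVLne t) h1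
  have hQ0 : PowerSeries.constantCoeff Q = c₀ := by
    have h := hQt 0
    rwa [pow_zero, sub_self, pow_zero, mul_one, ColumnTwist.tsum_coeff_mul_zero_pow] at h
  have hQ1 : ∑' n, PowerSeries.coeff n Q * (u - 1) ^ n = c₀ * d := by simpa using hQt 1
  set Q₁ : PowerSeries ℂ_[3] := PowerSeries.C c₀⁻¹ * Q with hQ₁
  have hODE₁ : (1 + PowerSeries.X) * PowerSeries.derivative ℂ_[3] Q₁ = PowerSeries.C (((z : ℚ_[3]) : ℂ_[3])) * Q₁ := by
    rw [hQ₁, Derivation.leibniz, PowerSeries.derivative_C, smul_zero, add_zero, smul_eq_mul, ← mul_assoc, mul_comm (1 + PowerSeries.X),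
      mul_assoc, hODE]
    ring
  have hQ₁0 : PowerSeries.constantCoeff Q₁ = 1 := by
    rw [hQ₁, map_mul, PowerSeries.constantCoeff_C, hQ0, inv_mul_cancel₀ hc₀0]
  have hQ₁val : HasSum (fun n ↦ PowerSeries.coeff n Q₁ * (u - 1) ^ n) d := by
    have hsum := (summable_coeff_mul_pow hQres (x := u - 1) hu.le).hasSum
    rw [hQ1] at hsum
    have h2 := hsum.mul_left c₀⁻¹
    rw [inv_mul_cancel_left₀ hc₀0] at h2
    refine h2.congr_fun fun n ↦ ?_
    rw [hQ₁, PowerSeries.coeff_C_mul, mul_assoc]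
  -- ### the group element `g₁` with `κ₁ g₁ = z`: `r₁(g₁) = (λ₀^m)⁻¹`; the twisted frame `L′ = [g₁]·L₂`
  obtain ⟨g₁, hg₁₁, -⟩ := hpair.exists_toAdd_apply_eq z 0
  have hr₁g₁ : avatarValueAt r₁ g₁ = d :=
    BinomialValues.avatarValueAt_eq_of_fst hpair hr₁κ hr₁γ₂ hg₁₁ hODE₁ hQ₁0 (by rwa [hr₁γ₁])
  set w₁ : ℂ_[3] := avatarValueAt r₂ g₁ with hw₁
  have hw₁1 : ‖w₁‖ = 1 := by
    have hlt : ‖w₁ - 1‖ < 1 := norm_avatarValueAt_sub_one_lt_of_factorsThroughPair hr₂κ g₁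
    have hne1 : ‖(1 : ℂ_[3])‖ ≠ ‖w₁ - 1‖ := by rw [norm_one]; exact hlt.ne'
    rw [show w₁ = 1 + (w₁ - 1) by ring, IsUltrametricDist.norm_add_eq_max_of_norm_ne_norm hne1, norm_one, max_eq_left hlt.le]
  have hw₁0 : w₁ ≠ 0 := norm_ne_zero_iff.mp (by rw [hw₁1]; exact one_ne_zero)
  set B₁ : PowerSeries (UnrSeries 3) := PowerSeries.map (PowerSeries.C (R := unrIntegers 3))
      ((PowerSeries.binomialSeries ℤ_[3] (Multiplicative.toAdd (κ₁ g₁))).map (toUnr 3)) *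
    PowerSeries.C ((PowerSeries.binomialSeries ℤ_[3] (Multiplicative.toAdd (κ₂ g₁))).map (toUnr 3)) with hB₁
  have hvalL' : ∀ i j, UnrSeries.HasValueAt₂ (B₁ * L₂) (v₁ ^ (j + 1) * u ^ (i + 1) - 1) (v₂ ^ (j + 1) - 1)
      (d ^ (i + 1) * w₁ ^ (j + 1) * VL i j) := by
    intro i j
    have hB := GradingRenormalisation.hasValueAt₂_groupLike hpair (hrκ i j) g₁
    rw [hx i j, hy i j, hprod, hr₁g₁] at hB
    exact LineValue.hasValueAt₂_mul (hxlt i j) (hylt j) hB (hvalL i j)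
  set w : ℂ_[3] := lam ^ m * w₁⁻¹ with hw_def
  have hw0 : w ≠ 0 := mul_ne_zero hμ0 (inv_ne_zero hw₁0)
  have hwn : ‖w‖ ≤ 1 := by rw [hw_def, norm_mul, norm_inv, hμ1, hw₁1, inv_one, mul_one]
  have hvalGw : ∀ i j, UnrSeries.HasValueAt₂ G (v₁ ^ (j + 1) * u ^ (i + 1) - 1) (v₂ ^ (j + 1) - 1)
      (w ^ (j + 1) * (d ^ (i + 1) * w₁ ^ (j + 1) * VL i j)) := by
    intro i j
    have h := hvalG i j
    have hww : w * w₁ = lam ^ m := by rw [hw_def, mul_assoc, inv_mul_cancel₀ hw₁0, mul_one]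
    have e : VG i j = w ^ (j + 1) * (d ^ (i + 1) * w₁ ^ (j + 1) * VL i j) := by
      rw [hVGd, ← hww, mul_pow]; ring
    rwa [e] at h
  have hB₁L0 : B₁ * L₂ ≠ 0 := by
    intro h0
    exact hL0 (((FrameUniqueness.isUnit_groupLike (p := 3) _ _).mul_right_eq_zero).mp h0)
  -- ### (2) COLUMN TWIST in the second variable: `w = Q₂(v₂ − 1)`
  obtain ⟨e, Q₂, hODE₂, hQ₂0, -, hQ₂val⟩ :=
    ColumnTwist.exists_binomial_of_column_twist (x := fun i j ↦ v₁ ^ (j + 1) * u ^ (i + 1) - 1) hpt hinjF hv₂ hv₂t hwn hw0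
      hvalL' hvalGw hB₁L0
  -- ### the group element `g′` with coordinates `(0, e)`: `r₂(g′) = w`, `r₁(g′) = 1`
  obtain ⟨g', hg'₁, hg'₂⟩ := hpair.exists_toAdd_apply_eq 0 e
  have hr₂g' : avatarValueAt r₂ g' = w :=
    BinomialValues.avatarValueAt_eq_of_snd hpair hr₂κ hg'₁ hg'₂ hODE₂ hQ₂0 (by rwa [hr₂γ₂])
  have hr₁g' : avatarValueAt r₁ g' = 1 :=
    BinomialValues.avatarValueAt_eq_of_snd hpair hr₁κ hg'₁ hg'₂ hODE₂ hQ₂0 (by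
      rw [hr₁γ₂, sub_self, ← hQ₂0]; exact hasSum_coeff_mul_zero_pow Q₂)
  -- ### (3) `g₀ = g₁ g′`: `r₁(g₀) = (λ₀^m)⁻¹`, `r₂(g₀) = λ₀^m`, so `[g₀]` has the grid values of `G / L₂`
  refine ⟨g₁ * g', ?_⟩
  have hr₁g₀ : avatarValueAt r₁ (g₁ * g') = d := by rw [avatarValueAt_mul, hr₁g₁, hr₁g', mul_one]
  have hr₂g₀ : avatarValueAt r₂ (g₁ * g') = lam ^ m := by
    rw [avatarValueAt_mul, hr₂g', ← hw₁, hw_def, mul_comm (lam ^ m), ← mul_assoc, mul_inv_cancel₀ hw₁0, one_mul]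
  set B : PowerSeries (UnrSeries 3) := PowerSeries.map (PowerSeries.C (R := unrIntegers 3))
      ((PowerSeries.binomialSeries ℤ_[3] (Multiplicative.toAdd (κ₁ (g₁ * g')))).map (toUnr 3)) *
    PowerSeries.C ((PowerSeries.binomialSeries ℤ_[3] (Multiplicative.toAdd (κ₂ (g₁ * g')))).map (toUnr 3)) with hB
  have hvalBL : ∀ i j, UnrSeries.HasValueAt₂ (B * L₂) (v₁ ^ (j + 1) * u ^ (i + 1) - 1) (v₂ ^ (j + 1) - 1) (VG i j) := by
    intro i j
    have hBv := GradingRenormalisation.hasValueAt₂_groupLike hpair (hrκ i j) (g₁ * g')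
    rw [hx i j, hy i j, hprod, hr₁g₀, hr₂g₀] at hBv
    have h := LineValue.hasValueAt₂_mul (hxlt i j) (hylt j) hBv (hvalL i j)
    rwa [← hVGd] at h
  have hzero : G - B * L₂ = 0 := by
    refine ReflectionTransfer.unr_eq_zero_of_infinite_zeros₂_innerFibred h30 h31 (Set.infinite_range_of_injective hinjD) ?_ ?_
    · rintro y ⟨j, rfl⟩; exact hv₂pow j
    · rintro y ⟨j, rfl⟩
      refine Set.infinite_of_injective_forall_mem (hinjF j) fun i ↦ ⟨hpt i j, ?_⟩
      have h := (hvalG i j).sub (hvalBL i j)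
      rwa [sub_self] at h
  exact sub_eq_zero.mp hzero

/-- **EVERY ♯♯-FRAME SATISFIES THE SYMMETRY CLAUSE: `Associated (φ_{A_τ} L₂) L₂`** (same frame as above; `X, Y ≠ 0`; no condition on the
grading ratio `X·κ̂/Y`): the group-like element of `exists_frameSubst_eq_groupLike_mul` is a unit (`…FrameUniqueness.isUnit_groupLike`). This is
clause (ii) of the v5–v8.2 first stub `stub_toricExistsSymmUpTo2` of the line `ratwall_thin_comb`, for every witness of clause (i).
[cite: HaoLoeffler2025, §4 Thm. 4.9 (arXiv:2405.12611)] [cite: BuyukbodukLei2017, Def. 3.8 (arXiv:1707.00557)] [cite: Jacquet1972, §19 Thm. 19.14, Cor. 19.15] -/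
theorem associated_frameSubst (hJ : jacquet1972_functionalEquation_rankinSelbergHecke_cone)
    (hK : IsImaginaryQuadratic K) {N : ℕ} [NeZero N] (W : WeierstrassCurve ℚ)
    (Dt : Literature.NumberTheory.EllipticCurves.ModularForms.ModularParametrizationData W N)
    (hH : SatisfiesHeegnerHypothesis N K)
    {𝔭 : HeightOneSpectrum (𝓞 K)} (h3 : ((3 : ℕ) : 𝓞 K) ∈ 𝔭.asIdeal)
    {𝔭' : HeightOneSpectrum (𝓞 K)} (h3' : ((3 : ℕ) : 𝓞 K) ∈ 𝔭'.asIdeal) (hne : 𝔭' ≠ 𝔭)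
    (ι' : PadicAlgCl 3 ≃+* ℂ) (hι : Summit.BirchSwinnertonDyer.BirchSwinnertonDyer.Theorems.SchneiderFree.BranchInducesPrime 3 ι' 𝔭)
    {κ₁ κ₂ : ZpExtension K 3} {γ₁ γ₂ : absoluteGaloisGroup K} (hpair : ZpExtension.IsTopGeneratorPair κ₁ κ₂ γ₁ γ₂)
    (hur₁ : ∀ v : HeightOneSpectrum (𝓞 K), v ≠ 𝔭 → ∀ 𝔓 ∈ v.primesAbove,
      𝔓.inertia (absoluteGaloisGroup K) ≤ κ₁.kerSubgroup)
    {c : absoluteGaloisGroup ℚ} (hc : c ∉ Set.range (absGaloisRestrict ℚ K))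
    {τ : absoluteGaloisGroup K → absoluteGaloisGroup K}
    (hτ : ∀ σ, absGaloisRestrict ℚ K (τ σ) = c * (absGaloisRestrict ℚ K σ)⁻¹ * c⁻¹)
    (A : GL (Fin 2) ℤ_[3]) (hA : (A : Matrix (Fin 2) (Fin 2) ℤ_[3]) = IwasawaAlgebra₂.frameMatrixOf κ₁ κ₂ γ₁ γ₂ τ)
    {ΩK : ℂ} {C X Y : ℂ_[3]} {L₂ : PowerSeries (UnrSeries 3)} (hX : X ≠ 0) (hY : Y ≠ 0)
    (hL : IsToricTwoVarLFunctionUpTo₂ C X Y ι' 𝔭 𝔭' κ₁ κ₂ γ₁ γ₂ Dt.f ΩK L₂) :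
    letI : Algebra ℤ_[3] (unrIntegers 3) := (toUnr 3).toAlgebra
    Associated (IwasawaAlgebra₂.frameSubst (unrIntegers 3) A L₂) L₂ := by
  letI : Algebra ℤ_[3] (unrIntegers 3) := (toUnr 3).toAlgebra
  obtain ⟨g₀, hg₀⟩ := exists_frameSubst_eq_groupLike_mul hJ hK W Dt hH h3 h3' hne ι' hι hpair hur₁ hc hτ A hA hX hY hL
  obtain ⟨Bu, hBu⟩ := FrameUniqueness.isUnit_groupLike (p := 3) (Multiplicative.toAdd (κ₁ g₀)) (Multiplicative.toAdd (κ₂ g₀))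
  exact ⟨Bu⁻¹, by rw [hg₀, ← hBu, mul_comm ((Bu : PowerSeries (UnrSeries 3))) L₂, mul_assoc, Units.mul_inv, mul_one]⟩

end Summit.BirchSwinnertonDyer.BirchSwinnertonDyer.Theorems.UniversalToricDescentThinComb.FrameFunctionalEquation

end
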